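import Mathlib
import HarnessLib
import Literature.Computability.LeeEtAl2017.PoisonSemantics

/-!
# LLVM Language Reference Manual, release 18.1.3: integer min/max/abs, saturating, bit-counting intrinsics and the integer casts

Source followed verbatim: *LLVM Language Reference Manual*, release 18.1.3 [LLVMLangRef18] — the file
`docs/LangRef.rst` at tag `llvmorg-18.1.3` (pinned copy `inputs/llvm-18.1.3.src/docs/LangRef.rst` of the
CertifiedToolchain cell, 28 110 lines; tarball sha256 fa6db895…bc00).  Every declaration below carries the section
title and the LINE RANGE of that pinned file it transcribes, with the normative sentence quoted.  This is a versioned,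
archived manual (the normative specification the pinned compiler ships); it is typed here because the PLDI'15 /
PLDI'17 / PLDI'21 papers typed in `LopesEtAl2015`, `LeeEtAl2017`, `LopesEtAl2021` do not print rules for these
constructs.

Printed (§'Poison Values', L4553–4556): "Most instructions return '``poison``' when one of their arguments is
'``poison``'. A notable exception is the :ref:`select instruction <i_select>`. Propagation of poison can be stopped
with the :ref:`freeze instruction <i_freeze>`."
Printed (§'llvm.smax.*', L14389): "Return the larger of ``%a`` and ``%b`` comparing the values as signed integers."
(§'llvm.smin.*', L14420): "Return the smaller of ``%a`` and ``%b`` comparing the values as signed integers."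
(§'llvm.umax.*', L14451–14452): "Return the larger of ``%a`` and ``%b`` comparing the values as unsigned integers."
(§'llvm.umin.*', L14482–14483): "Return the smaller of ``%a`` and ``%b`` comparing the values as unsigned integers."
Printed (§'llvm.abs.*', L14364–14367): "The '``llvm.abs``' intrinsic returns the magnitude (always positive) of the
argument or each element of a vector argument.". If the argument is ``INT_MIN``, then the result is also ``INT_MIN``
if ``is_int_min_poison == 0`` and ``poison`` otherwise."
Printed (§'Saturation Arithmetic Intrinsics', L16705–16709): "Saturation arithmetic is a version of arithmetic in
which operations are limited to a fixed range between a minimum and maximum value. If the result of an operation is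
greater than the maximum value, the result is set (or "clamped") to this maximum. If it is below the minimum, it is
clamped to this minimum."  (§'llvm.sadd.sat.*', L16731–16732, L16744–16746): "perform signed saturating addition on
the 2 arguments", "The maximum value this operation can clamp to is the largest signed value representable by the bit
width of the arguments. The minimum value is the smallest signed value representable by this bit width."
(§'llvm.uadd.sat.*', L16792–16794): "The maximum value this operation can clamp to is the largest unsigned value
representable by the bit width of the arguments. Because this is an unsigned operation, the result will never saturate
towards zero."  (§'llvm.ssub.sat.*', L16839–16841): as sadd.sat.  (§'llvm.usub.sat.*', L16887–16890): "The minimum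
value this operation can clamp to is 0 […] the result will never saturate towards the largest possible value".
Printed (§'llvm.ctpop.*', L16180–16181): "The '``llvm.ctpop``' intrinsic counts the 1's in a variable".
(§'llvm.ctlz.*', L16223–16227): "counts the leading (most significant) zeros in a variable […]. If ``src == 0`` then
the result is the size in bits of the type of ``src`` if ``is_zero_poison == 0`` and ``poison`` otherwise. For example,
``llvm.ctlz(i32 2) = 30``."  (§'llvm.cttz.*', L16269–16273): "counts the trailing (least significant) zeros in a
variable […]. If ``src == 0`` then the result is the size in bits of the type of ``src`` if ``is_zero_poison == 0``
and ``poison`` otherwise. For example, ``llvm.cttz(2) = 1``."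
Printed (§'trunc .. to', L11255–11258): "The '``trunc``' instruction truncates the high order bits in ``value`` and
converts the remaining bits to ``ty2``. […] It will always truncate bits."  (§'zext .. to', L11302–11308): "The
``zext`` fills the high order bits of the ``value`` with zero bits until it reaches the size of the destination type,
``ty2``. When zero extending from i1, the result will always be either 0 or 1. If the ``nneg`` flag is set, and the
``zext`` argument is negative, the result is a poison value."  (§'sext .. to', L11350–11354): "The '``sext``'
instruction performs a sign extension by copying the sign bit (highest order bit) of the ``value`` until it reaches
the bit size of the type ``ty2``. When sign extending from i1, the extension always results in -1 or 0."

## What is formalised and what is not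
Scalar integers only (the vector forms of every section are omitted).  Values on DEFINED operands are typed as
functions on `BitVec w` exactly as the sentences say (`…V` names); the instruction on the poison-or-defined domain
`⟦iw⟧ = LeeEtAl2017.IVal w` is the poison-STRICT lift per the 'Poison Values' sentence L4553–4554 ("Most instructions
return poison when one of their arguments is poison") — the intrinsic sections themselves do not restate poison
propagation; that reading (which is also Alive2's) is the one recorded here and flagged as such.  Where an operand
value makes the result poison (`llvm.abs` with `is_int_min_poison`, `ctlz`/`cttz` with `is_zero_poison`, `zext nneg`)
the text is explicit and typed verbatim.  Ties in min/max ("the larger"/"the smaller" of two equal values) return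
that common value, so the orientation of the `if` is immaterial (`smax_comm_of_eq` etc. are not needed and not
stated).  Not typed: `llvm.sshl.sat/ushl.sat`, the `*.with.overflow` family, `fshl/fshr`, `bitreverse/bswap`, and
anything about `undef` (outside the `⊎ {poison}` domain).  No claim is made here about what LLVM's optimiser does
with these constructs; this is the specification text only.
-/

namespace Literature.Computability.LLVMLangRef18

open Literature.Computability.LeeEtAl2017

variable {w v : ℕ}

/-! ## Poison propagation through these instructions (§'Poison Values') -/

/-- "Most instructions return '``poison``' when one of their arguments is '``poison``'. A notable exception is the
select instruction." — the unary poison-strict lift used for every one-operand construct below.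
[cite: LLVMLangRef18, §'Poison Values' L4553–4556] -/
def strict₁ (f : BitVec v → IVal w) (a : IVal v) : IVal w := a.bind f

/-- A poison operand gives poison. [cite: LLVMLangRef18, §'Poison Values' L4553–4554] -/
@[simp] theorem strict₁_poison (f : BitVec v → IVal w) : strict₁ f IVal.poison = IVal.poison := rfl

/-- A defined operand gives the construct's own clause. [cite: LLVMLangRef18, §'Poison Values' L4553–4554] -/
@[simp] theorem strict₁_some (f : BitVec v → IVal w) (x : BitVec v) : strict₁ f (some x) = f x := rfl

/-! ## `llvm.smax` / `llvm.smin` / `llvm.umax` / `llvm.umin` -/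

/-- "Return the larger of ``%a`` and ``%b`` comparing the values as signed integers."
[cite: LLVMLangRef18, §'llvm.smax.*' L14372–14402 (Overview L14389)] -/
def smaxV (a b : BitVec w) : BitVec w := if b.toInt ≤ a.toInt then a else b

/-- "Return the smaller of ``%a`` and ``%b`` comparing the values as signed integers."
[cite: LLVMLangRef18, §'llvm.smin.*' L14403–14433 (Overview L14420)] -/
def sminV (a b : BitVec w) : BitVec w := if a.toInt ≤ b.toInt then a else b

/-- "Return the larger of ``%a`` and ``%b`` comparing the values as unsigned integers."
[cite: LLVMLangRef18, §'llvm.umax.*' L14434–14464 (Overview L14451–14452)] -/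
def umaxV (a b : BitVec w) : BitVec w := if b.toNat ≤ a.toNat then a else b

/-- "Return the smaller of ``%a`` and ``%b`` comparing the values as unsigned integers."
[cite: LLVMLangRef18, §'llvm.umin.*' L14465–14495 (Overview L14482–14483)] -/
def uminV (a b : BitVec w) : BitVec w := if a.toNat ≤ b.toNat then a else b

/-- `llvm.smax` on `⟦iw⟧` (poison-strict, §'Poison Values'). [cite: LLVMLangRef18, §'llvm.smax.*' L14389 and L4553–4554] -/
def smax (a b : IVal w) : IVal w := IVal.strict₂ (fun x y => some (smaxV x y)) a b
/-- `llvm.smin` on `⟦iw⟧`. [cite: LLVMLangRef18, §'llvm.smin.*' L14420 and L4553–4554] -/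
def smin (a b : IVal w) : IVal w := IVal.strict₂ (fun x y => some (sminV x y)) a b
/-- `llvm.umax` on `⟦iw⟧`. [cite: LLVMLangRef18, §'llvm.umax.*' L14451–14452 and L4553–4554] -/
def umax (a b : IVal w) : IVal w := IVal.strict₂ (fun x y => some (umaxV x y)) a b
/-- `llvm.umin` on `⟦iw⟧`. [cite: LLVMLangRef18, §'llvm.umin.*' L14482–14483 and L4553–4554] -/
def umin (a b : IVal w) : IVal w := IVal.strict₂ (fun x y => some (uminV x y)) a b

/-- The larger (signed) is one of the two and is `≥` both. [cite: LLVMLangRef18, §'llvm.smax.*' L14389] -/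
theorem smaxV_spec (a b : BitVec w) :
    (smaxV a b = a ∨ smaxV a b = b) ∧ a.toInt ≤ (smaxV a b).toInt ∧ b.toInt ≤ (smaxV a b).toInt := by
  unfold smaxV; split <;> refine ⟨by simp, ?_, ?_⟩ <;> omega

/-- The smaller (unsigned) is one of the two and is `≤` both. [cite: LLVMLangRef18, §'llvm.umin.*' L14482–14483] -/
theorem uminV_spec (a b : BitVec w) :
    (uminV a b = a ∨ uminV a b = b) ∧ (uminV a b).toNat ≤ a.toNat ∧ (uminV a b).toNat ≤ b.toNat := by
  unfold uminV; split <;> refine ⟨by simp, ?_, ?_⟩ <;> omega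

/-! ## `llvm.abs` -/

/-- "The '``llvm.abs``' intrinsic returns the magnitude (always positive) of the argument […]. If the argument is
``INT_MIN``, then the result is also ``INT_MIN`` if ``is_int_min_poison == 0`` and ``poison`` otherwise."  On a
defined operand: poison iff the flag is set and the operand is `INT_MIN`; else the two's-complement magnitude
(`-x` for negative `x`, which for `INT_MIN` is `INT_MIN` again).
[cite: LLVMLangRef18, §'llvm.abs.*' L14329–14367 (Semantics L14364–14367; flag L14356–14359)] -/
def absV (isIntMinPoison : Bool) (x : BitVec w) : IVal w :=
  if isIntMinPoison = true ∧ x = BitVec.intMin w then IVal.poison else some (if x.toInt < 0 then -x else x)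

/-- `llvm.abs` on `⟦iw⟧`. [cite: LLVMLangRef18, §'llvm.abs.*' L14364–14367 and §'Poison Values' L4553–4554] -/
def abs (isIntMinPoison : Bool) (a : IVal w) : IVal w := strict₁ (absV isIntMinPoison) a

/-- "If the argument is ``INT_MIN``, then the result is also ``INT_MIN`` if ``is_int_min_poison == 0``".
[cite: LLVMLangRef18, §'llvm.abs.*' L14365–14367] -/
theorem absV_intMin_false : absV false (BitVec.intMin w) = some (BitVec.intMin w) := by
  simp [absV, BitVec.neg_intMin]

/-- "… and ``poison`` otherwise." [cite: LLVMLangRef18, §'llvm.abs.*' L14365–14367] -/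
theorem absV_intMin_true : absV true (BitVec.intMin w) = IVal.poison := by
  simp [absV]

/-! ## Saturating add / sub (§'Saturation Arithmetic Intrinsics') -/

/-- `llvm.sadd.sat`: "signed saturating addition" — the exact signed sum clamped to `[smallest, largest signed
value]`: `INT_MIN` below, `INT_MAX` above, else the (then exact) sum.
[cite: LLVMLangRef18, §'llvm.sadd.sat.*' L16712–16757 (Semantics L16744–16746); clamping L16705–16709] -/
def saddSatV (x y : BitVec w) : BitVec w :=
  if x.toInt + y.toInt < -((2 ^ (w - 1) : ℕ) : ℤ) then BitVec.intMin w
  else if ((2 ^ (w - 1) : ℕ) : ℤ) ≤ x.toInt + y.toInt then BitVec.intMax w else x + y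

/-- `llvm.uadd.sat`: unsigned saturating addition — clamps to "the largest unsigned value representable" on
carry, "will never saturate towards zero".
[cite: LLVMLangRef18, §'llvm.uadd.sat.*' L16760–16804 (Semantics L16792–16794)] -/
def uaddSatV (x y : BitVec w) : BitVec w :=
  if 2 ^ w ≤ x.toNat + y.toNat then BitVec.allOnes w else x + y

/-- `llvm.ssub.sat`: signed saturating subtraction, clamped as `sadd.sat`.
[cite: LLVMLangRef18, §'llvm.ssub.sat.*' L16807–16852 (Semantics L16839–16841)] -/
def ssubSatV (x y : BitVec w) : BitVec w :=
  if x.toInt - y.toInt < -((2 ^ (w - 1) : ℕ) : ℤ) then BitVec.intMin w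
  else if ((2 ^ (w - 1) : ℕ) : ℤ) ≤ x.toInt - y.toInt then BitVec.intMax w else x - y

/-- `llvm.usub.sat`: unsigned saturating subtraction — "The minimum value this operation can clamp to is 0 […]
the result will never saturate towards the largest possible value".
[cite: LLVMLangRef18, §'llvm.usub.sat.*' L16855–16899 (Semantics L16887–16890)] -/
def usubSatV (x y : BitVec w) : BitVec w :=
  if x.toNat < y.toNat then 0#w else x - y

/-- `llvm.sadd.sat` on `⟦iw⟧`. [cite: LLVMLangRef18, §'llvm.sadd.sat.*' L16744–16746 and L4553–4554] -/
def saddSat (a b : IVal w) : IVal w := IVal.strict₂ (fun x y => some (saddSatV x y)) a b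
/-- `llvm.uadd.sat` on `⟦iw⟧`. [cite: LLVMLangRef18, §'llvm.uadd.sat.*' L16792–16794 and L4553–4554] -/
def uaddSat (a b : IVal w) : IVal w := IVal.strict₂ (fun x y => some (uaddSatV x y)) a b
/-- `llvm.ssub.sat` on `⟦iw⟧`. [cite: LLVMLangRef18, §'llvm.ssub.sat.*' L16839–16841 and L4553–4554] -/
def ssubSat (a b : IVal w) : IVal w := IVal.strict₂ (fun x y => some (ssubSatV x y)) a b
/-- `llvm.usub.sat` on `⟦iw⟧`. [cite: LLVMLangRef18, §'llvm.usub.sat.*' L16887–16890 and L4553–4554] -/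
def usubSat (a b : IVal w) : IVal w := IVal.strict₂ (fun x y => some (usubSatV x y)) a b

/-- The printed `i4` examples of §'llvm.sadd.sat.*' (L16754–16757): `sadd.sat(1,2) = 3`, `(5,6) = 7`,
`(-4,2) = -2`, `(-4,-5) = -8`. [cite: LLVMLangRef18, §'llvm.sadd.sat.*' L16754–16757] -/
theorem saddSat_examples :
    saddSatV (1#4) (2#4) = 3#4 ∧ saddSatV (5#4) (6#4) = 7#4 ∧ saddSatV (-4#4) (2#4) = -2#4 ∧
      saddSatV (-4#4) (-5#4) = -8#4 := by
  decide

/-- The printed `i4` examples of §'llvm.uadd.sat.*' (L16802–16804): `(1,2) = 3`, `(5,6) = 11`, `(8,8) = 15`.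
[cite: LLVMLangRef18, §'llvm.uadd.sat.*' L16802–16804] -/
theorem uaddSat_examples : uaddSatV (1#4) (2#4) = 3#4 ∧ uaddSatV (5#4) (6#4) = 11#4 ∧ uaddSatV (8#4) (8#4) = 15#4 := by
  decide

/-- The printed `i4` examples of §'llvm.ssub.sat.*' (L16849–16852): `(2,1) = 1`, `(2,6) = -4`, `(-4,5) = -8`,
`(4,-5) = 7`. [cite: LLVMLangRef18, §'llvm.ssub.sat.*' L16849–16852] -/
theorem ssubSat_examples :
    ssubSatV (2#4) (1#4) = 1#4 ∧ ssubSatV (2#4) (6#4) = -4#4 ∧ ssubSatV (-4#4) (5#4) = -8#4 ∧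
      ssubSatV (4#4) (-5#4) = 7#4 := by
  decide

/-- The printed `i4` examples of §'llvm.usub.sat.*' (L16898–16899): `(2,1) = 1`, `(2,6) = 0`.
[cite: LLVMLangRef18, §'llvm.usub.sat.*' L16898–16899] -/
theorem usubSat_examples : usubSatV (2#4) (1#4) = 1#4 ∧ usubSatV (2#4) (6#4) = 0#4 := by
  decide

/-! ## `llvm.ctpop` / `llvm.ctlz` / `llvm.cttz` -/

/-- "The '``llvm.ctpop``' intrinsic counts the 1's in a variable" — the number of set bit positions, as a `w`-bit
number. [cite: LLVMLangRef18, §'llvm.ctpop.*' L16145–16181 (Semantics L16180–16181)] -/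
def ctpopV (x : BitVec w) : BitVec w := BitVec.ofNat w x.toNat.bitIndices.length

/-- `llvm.ctpop` on `⟦iw⟧` (never creates poison). [cite: LLVMLangRef18, §'llvm.ctpop.*' L16180–16181 and L4553–4554] -/
def ctpop (a : IVal w) : IVal w := strict₁ (fun x => some (ctpopV x)) a

/-- "The '``llvm.ctlz``' intrinsic counts the leading (most significant) zeros in a variable […]. If ``src == 0``
then the result is the size in bits of the type of ``src`` if ``is_zero_poison == 0`` and ``poison`` otherwise."
For `src ≠ 0` the count is `w − 1 − ⌊log₂ src⌋`. [cite: LLVMLangRef18, §'llvm.ctlz.*' L16185–16227 (Semantics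
L16223–16227; flag L16213–16215)] -/
def ctlzV (isZeroPoison : Bool) (x : BitVec w) : IVal w :=
  if x = 0#w then (if isZeroPoison then IVal.poison else some (BitVec.ofNat w w))
  else some (BitVec.ofNat w (w - 1 - Nat.log2 x.toNat))

/-- "The '``llvm.cttz``' intrinsic counts the trailing (least significant) zeros in a variable […]. If ``src == 0``
then the result is the size in bits of the type of ``src`` if ``is_zero_poison == 0`` and ``poison`` otherwise."
For `src ≠ 0` the number of trailing zero bits is the exponent of the largest power of two dividing `src`
(`padicValNat 2`). [cite: LLVMLangRef18, §'llvm.cttz.*' L16231–16273 (Semantics L16269–16273; flag L16259–16261)] -/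
def cttzV (isZeroPoison : Bool) (x : BitVec w) : IVal w :=
  if x = 0#w then (if isZeroPoison then IVal.poison else some (BitVec.ofNat w w))
  else some (BitVec.ofNat w (padicValNat 2 x.toNat))

/-- `llvm.ctlz` on `⟦iw⟧`. [cite: LLVMLangRef18, §'llvm.ctlz.*' L16223–16227 and L4553–4554] -/
def ctlz (isZeroPoison : Bool) (a : IVal w) : IVal w := strict₁ (ctlzV isZeroPoison) a
/-- `llvm.cttz` on `⟦iw⟧`. [cite: LLVMLangRef18, §'llvm.cttz.*' L16269–16273 and L4553–4554] -/
def cttz (isZeroPoison : Bool) (a : IVal w) : IVal w := strict₁ (cttzV isZeroPoison) a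

/-- The printed example "``llvm.ctlz(i32 2) = 30``". [cite: LLVMLangRef18, §'llvm.ctlz.*' L16227] -/
theorem ctlz_example : ctlzV false (2#32) = some (30#32) := by
  decide

/-- Zero input: the width if the flag is clear, poison if set (both counting intrinsics).
[cite: LLVMLangRef18, §'llvm.ctlz.*' L16224–16226; §'llvm.cttz.*' L16270–16272] -/
theorem ctz_zero (p : Bool) :
    ctlzV p (0#w) = (if p then IVal.poison else some (BitVec.ofNat w w)) ∧
      cttzV p (0#w) = (if p then IVal.poison else some (BitVec.ofNat w w)) := by
  simp [ctlzV, cttzV]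

/-! ## `trunc` / `zext` / `sext` -/

/-- "The '``trunc``' instruction truncates the high order bits in ``value`` and converts the remaining bits to
``ty2``." (release 18.1.3 has no `nuw`/`nsw` flags on `trunc`).
[cite: LLVMLangRef18, §'trunc .. to' L11228–11258 (Semantics L11255–11258)] -/
def truncV (v : ℕ) (x : BitVec w) : BitVec v := x.setWidth v

/-- "The ``zext`` fills the high order bits of the ``value`` with zero bits until it reaches the size of the
destination type". [cite: LLVMLangRef18, §'zext .. to' L11272–11308 (Semantics L11302–11303)] -/
def zextV (v : ℕ) (x : BitVec w) : BitVec v := x.setWidth v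

/-- "If the ``nneg`` flag is set, and the ``zext`` argument is negative, the result is a poison value."
[cite: LLVMLangRef18, §'zext .. to' L11307–11308] -/
def zextNNegV (v : ℕ) (x : BitVec w) : IVal v := if x.msb = true then IVal.poison else some (x.setWidth v)

/-- "The '``sext``' instruction performs a sign extension by copying the sign bit (highest order bit) of the
``value`` until it reaches the bit size of the type ``ty2``."
[cite: LLVMLangRef18, §'sext .. to' L11324–11354 (Semantics L11350–11352)] -/
def sextV (v : ℕ) (x : BitVec w) : BitVec v := x.signExtend v

/-- `trunc` on `⟦iw⟧` (poison-strict). [cite: LLVMLangRef18, §'trunc .. to' L11255–11258 and L4553–4554] -/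
def trunc (v : ℕ) (a : IVal w) : IVal v := strict₁ (fun x => some (truncV v x)) a
/-- `zext` on `⟦iw⟧`. [cite: LLVMLangRef18, §'zext .. to' L11302–11303 and L4553–4554] -/
def zext (v : ℕ) (a : IVal w) : IVal v := strict₁ (fun x => some (zextV v x)) a
/-- `zext nneg` on `⟦iw⟧`. [cite: LLVMLangRef18, §'zext .. to' L11307–11308 and L4553–4554] -/
def zextNNeg (v : ℕ) (a : IVal w) : IVal v := strict₁ (zextNNegV v) a
/-- `sext` on `⟦iw⟧`. [cite: LLVMLangRef18, §'sext .. to' L11350–11352 and L4553–4554] -/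
def sext (v : ℕ) (a : IVal w) : IVal v := strict₁ (fun x => some (sextV v x)) a

/-- "When zero extending from i1, the result will always be either 0 or 1."
[cite: LLVMLangRef18, §'zext .. to' L11305] -/
theorem zextV_i1 (v : ℕ) (x : BitVec 1) : zextV v x = 0#v ∨ zextV v x = 1#v := by
  rcases BitVec.eq_zero_or_eq_one x with h | h <;> subst h
  · left; simp [zextV]
  · right; apply BitVec.eq_of_toNat_eq; simp [zextV, BitVec.toNat_setWidth]

/-- "When sign extending from i1, the extension always results in -1 or 0."
[cite: LLVMLangRef18, §'sext .. to' L11354] -/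
theorem sextV_i1 (v : ℕ) (x : BitVec 1) : sextV v x = -1#v ∨ sextV v x = 0#v := by
  rcases BitVec.eq_zero_or_eq_one x with h | h <;> subst h
  · right
    simp only [sextV]
    rw [BitVec.signExtend_eq_setWidth_of_msb_false (by decide)]
    simp
  · left
    simp only [sextV]
    rw [BitVec.signExtend_eq_not_setWidth_not_of_msb_true (by decide)]
    have h1 : ~~~(1#1) = 0#1 := by decide
    rw [h1, BitVec.setWidth_zero, BitVec.not_zero, BitVec.neg_one_eq_allOnes]

end Literature.Computability.LLVMLangRef18
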